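import Literature.NumberTheory.EllipticCurves.FormalGroupChart
import Literature.NumberTheory.EllipticCurves.GoodModelInertiaCriterionProofs
import Literature.NumberTheory.EllipticCurves.SerreOpenImageTameKummerProofs
import Literature.NumberTheory.EllipticCurves.OrdinaryReductionKernelTorsionProofs
import Literature.NumberTheory.EllipticCurves.KernelReductionInertiaProofs
import Literature.NumberTheory.EllipticCurves.OpenImageMazurInputs
import Literature.NumberTheory.EllipticCurves.VariableChangePointsMap
import Mathlib.AlgebraicGeometry.EllipticCurve.NormalForms
import HarnessLib

/-!
# Route `IsogenyGlueCongruence`, crux `MazurKenkuBound` (stmt-ABC-15125) — line `Sketch`, stub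
# `stub_range_of` (Mazur 1978 Prop. 5.1 by tame characters), part 1: the place above `N`,
# congruences modulo its maximal ideal, inertia on the reduction

Helpers (`--supports stmt-ABC-15125`) for the registered stub `stub_range_of` of the line lead's
skeleton `Cruxes/MazurKenkuBound/Lines/Sketch.lean` (the theorem itself is in
`IsogenyGlueCongruenceMazurKenkuBoundStubRangeOf`). This file: the local data at a prime `N` — a
prime `𝔓 ∣ N` of `\bar ℤ` and an `ℝ≥0`-valued valuation `w` of `ℚ̄` (the spectral valuation of
`\bar ℚ_N` pulled back along an embedding cutting out `𝔓`) with its inertial isometries, the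
values of integers and rationals and the surjectivity of the tame Kummer characters on `I_𝔓`
(`exists_placeData`); the parameter `z = -x/y` under field automorphisms, transports and the
diagonal change of variables; congruences `xᵏ ≡ yᵏ`, distinctness of roots of unity of order
prime to `N` modulo the maximal ideal, `a ≡ cᵏ⁰ (mod N)` read in `ℚ̄`, and the cyclotomic
comparison `ξ ≡ χ̄_N(τ)` (Serre 1972 §1 Prop. 8: `χ = θᵉ` on inertia); the Serre–Tate mechanism
with trivial reduced automorphism (an inertia element fixing the change of variables acts
trivially on the reduction of the good model, `goodReductionHom_nsmul_eq`).

References: [Mazur1978] B. Mazur, Invent. Math. 44 (1978), §5, proof of Prop. 5.1 (pp. 150–151);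
[Serre1972] J.-P. Serre, Invent. Math. 15 (1972), §1.3 (Prop. 1–2), §1 Prop. 8; [SilvermanAEC2009]
J. H. Silverman, *The Arithmetic of Elliptic Curves*, 2nd ed., III.1, IV.1, VII.1.3(d), VII.2.1.
-/

-- `Summit.<Summit>.<Problem>` is the mandated summit-side namespace (CONVENTIONS §2); for the
-- single-conjunct summit `ABC` the two coincide, so the duplicate `ABC.ABC` is deliberate.
set_option linter.dupNamespace false

noncomputable section

open scoped NNReal NumberField Classical

open WeierstrassCurve IsDedekindDomain Field NumberField
open Literature.NumberTheory.EllipticCurves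
open Literature.NumberTheory.GaloisRepresentations

-- The `ℚ`-algebra diamond on `AlgebraicClosure ℚ` (`DivisionRing.toRatAlgebra` vs
-- `AlgebraicClosure.instAlgebra`, defeq but not at instance transparency): the Galois-module
-- structures of the tree are keyed on the latter (same device as `GeomPointReduction`).
attribute [-instance] DivisionRing.toRatAlgebra

namespace Summit.ABC.ABC.Theorems

/-! ### A place of `ℚ̄` above `N`: the valuation, its inertia group, Kummer theory -/

/-- **The local data at `N`.** For a prime `N` there are: the place `v` of `ℚ` at `N`, a prime
`𝔓 ∣ v` of `\bar ℤ`, and an `ℝ≥0`-valued valuation `w` of `ℚ̄` (the spectral valuation of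
`\bar ℚ_N` pulled back along an embedding cutting out `𝔓`) such that: the inertia group `I_𝔓`
acts by `w`-isometries congruent to the identity modulo the maximal ideal; `|N| < 1`; integers
prime to `N` have `|n| = 1`; algebraic integers have `|x| ≤ 1`; rationals that are `v`-integral
have `|q| ≤ 1`; and the tame Kummer characters are surjective on `I_𝔓` (`π^m = N`, `ζ^m = 1` ⇒
`sπ = ζπ` for some `s ∈ I_𝔓`). Assembled from the tree (Neukirch II (4.8), (9.6); Serre 1972
§1.3). [cite: Serre1972, §1.3 Prop. 1–2] -/
theorem exists_placeData (N : ℕ) [Fact N.Prime] :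
    ∃ (v : HeightOneSpectrum (𝓞 ℚ)) (𝔓 : Ideal (absIntegers (𝓞 ℚ) ℚ))
      (w : Valuation (AlgebraicClosure ℚ) ℝ≥0),
      (N : 𝓞 ℚ) ∈ v.asIdeal ∧ 𝔓 ∈ v.primesAbove ∧
      (∀ τ ∈ 𝔓.inertia (absoluteGaloisGroup ℚ), ∀ z : AlgebraicClosure ℚ, w (τ • z) = w z) ∧
      (∀ τ ∈ 𝔓.inertia (absoluteGaloisGroup ℚ), ∀ z : AlgebraicClosure ℚ,
        w z ≤ 1 → w (τ • z - z) < 1) ∧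
      w (N : AlgebraicClosure ℚ) < 1 ∧
      (∀ n : ℤ, ¬ (N : ℤ) ∣ n → w (n : AlgebraicClosure ℚ) = 1) ∧
      (∀ x : AlgebraicClosure ℚ, IsIntegral ℤ x → w x ≤ 1) ∧
      (∀ q : ℚ, v.valuation ℚ q ≤ 1 → w (q : AlgebraicClosure ℚ) ≤ 1) ∧
      (∀ {m : ℕ}, 0 < m → ∀ {π ζ : AlgebraicClosure ℚ}, π ^ m = N → ζ ^ m = 1 →
        ∃ s ∈ 𝔓.inertia (absoluteGaloisGroup ℚ), s • π = ζ * π) := by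
  have hN : N.Prime := Fact.out
  -- the place `v` at `N`
  set v : HeightOneSpectrum (𝓞 ℚ) := Rat.HeightOneSpectrum.primesEquiv.symm ⟨N, hN⟩ with hvdef
  have hv : (Rat.HeightOneSpectrum.primesEquiv v : ℕ) = N := by
    rw [hvdef, Equiv.apply_symm_apply]
  have hvN : (N : 𝓞 ℚ) ∈ v.asIdeal := by
    have h := (Rat.HeightOneSpectrum.natGenerator_dvd_iff v).mp dvd_rfl
    rw [← map_natCast (Rat.IsIntegralClosure.intEquiv (𝓞 ℚ)), Ideal.apply_mem_of_equiv_iff] at h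
    have hgen : Rat.HeightOneSpectrum.natGenerator v = N := hv
    rwa [hgen] at h
  -- the embedding `ι : ℚ̄ → \bar ℚ_N`, the prime it cuts out, the spectral valuation
  let Kv := v.adicCompletion ℚ
  let Ω := AlgebraicClosure Kv
  haveI : CharZero Kv := charZero_of_injective_algebraMap (algebraMap ℚ Kv).injective
  set ι : AlgebraicClosure ℚ →ₐ[ℚ] Ω := closureEmb (K := ℚ) Kv with hι
  obtain ⟨𝔐, h𝔐⟩ := v.localPrimesAbove_nonempty
  set 𝔓 : Ideal (absIntegers (𝓞 ℚ) ℚ) := v.primeBelow ι 𝔐 with h𝔓def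
  have h𝔓 : 𝔓 ∈ v.primesAbove := HeightOneSpectrum.primeBelow_mem_primesAbove (ι := ι) h𝔐
  obtain ⟨ws, hws⟩ := v.exists_spectralValuation
  set w : Valuation (AlgebraicClosure ℚ) ℝ≥0 := ws.comap (ι : AlgebraicClosure ℚ →+* Ω) with hwdef
  have hw_apply : ∀ z : AlgebraicClosure ℚ, w z = ws (ι z) := fun z ↦ rfl
  -- local inertial isometries above the elements of `I_𝔓`
  have hlift : ∀ τ ∈ 𝔓.inertia (absoluteGaloisGroup ℚ),
      ∃ σ ∈ 𝔐.inertia (absoluteGaloisGroup Kv), ∀ x : AlgebraicClosure ℚ, ι (τ • x) = σ • ι x :=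
    fun τ hτ ↦ v.exists_mem_inertia_apply_eq_holds ι h𝔐 (τ := τ) hτ
  refine ⟨v, 𝔓, w, hvN, h𝔓, ?_, ?_, ?_, ?_, ?_, ?_, ?_⟩
  · intro τ hτ z
    obtain ⟨σ, -, hσ⟩ := hlift τ hτ
    rw [hw_apply, hw_apply, hσ]
    exact HeightOneSpectrum.spectralValuation_smul hws σ (ι z)
  · intro τ hτ z hz
    obtain ⟨σ, hσI, hσ⟩ := hlift τ hτ
    rw [hw_apply, map_sub, hσ]
    exact (HeightOneSpectrum.mem_inertia_iff_spectralValuation hws h𝔐).mp hσI (ι z) hz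
  · rw [hw_apply, map_natCast]
    exact HeightOneSpectrum.spectralValuation_natCast_lt_one hws hvN
  · intro n hn
    rw [hw_apply, map_intCast]
    exact HeightOneSpectrum.spectralValuation_intCast_eq_one_of_natCast_mem hvN hws hn
  · intro x hx
    have hx' : x ∈ absIntegers (𝓞 ℚ) ℚ := (mem_integralClosure_iff _ _).mpr hx.tower_top
    have h := (HeightOneSpectrum.mem_localAbsIntegers_iff_spectralValuation hws).mp
      (HeightOneSpectrum.absIntegersToLocal v ι ⟨x, hx'⟩).2
    rw [hw_apply]
    simpa only [HeightOneSpectrum.coe_absIntegersToLocal_apply] using h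
  · intro q hq
    rw [hw_apply, map_ratCast]
    have e1 : ((q : ℚ) : Ω) = algebraMap Kv Ω (algebraMap ℚ Kv q) := by
      rw [← IsScalarTower.algebraMap_apply ℚ Kv Ω q, eq_ratCast]
    rw [e1, HeightOneSpectrum.spectralValuation_algebraMap_le_one_iff hws,
      HeightOneSpectrum.mem_adicCompletionIntegers, HeightOneSpectrum.algebraMap_adicCompletion,
      Function.comp_apply, Algebra.algebraMap_self, RingHom.id_apply,
      HeightOneSpectrum.valuedAdicCompletion_eq_valuation']
    exact hq
  · intro m hm π ζ hπ hζ
    exact exists_mem_inertia_smul_eq_mul_of_pow_eq N hm hv h𝔓 hπ hζ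

/-! ### The parameter `z = -x/y` under maps -/

/-- The parameter `z = -x/y` is compatible with field automorphisms acting on coordinates.
[folklore] -/
theorem zCoord_map_algEquiv {F L : Type*} [Field F] [Field L] [Algebra F L]
    {V : WeierstrassCurve F} (σ : L ≃ₐ[F] L) (P : (V.baseChange L).toAffine.Point) :
    (Affine.Point.map (σ : L →ₐ[F] L) P).zCoord = σ P.zCoord := by
  rcases P with _ | ⟨x, y, h⟩
  · rw [← Affine.Point.zero_def, map_zero, Affine.Point.zCoord_zero, map_zero]
  · rw [Affine.Point.map_some, Affine.Point.zCoord_some, Affine.Point.zCoord_some]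
    change -σ x / σ y = σ (-x / y)
    rw [map_div₀, map_neg]

/-- Transport along an equality of equations does not change the parameter `z`. [folklore] -/
theorem zCoord_congrEquiv {L : Type*} [Field L] {W₁ W₂ : WeierstrassCurve L} (h : W₁ = W₂)
    (P : W₁.toAffine.Point) : (Affine.Point.congrEquiv h P).zCoord = P.zCoord := by
  subst h
  rfl

/-- Under the diagonal change of variables `(u; 0, 0, 0)` (`x' = u⁻²x`, `y' = u⁻³y`) the
parameter scales by `u`: `z' = u z` (Silverman AEC III.1 Table 3.1). [cite: SilvermanAEC2009, III.1 Table 3.1] -/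
theorem zCoord_pointEquiv_diag {L : Type*} [Field L] (V : WeierstrassCurve L) (u : Lˣ)
    (P : V.toAffine.Point) :
    (VariableChange.pointEquiv V ⟨u, 0, 0, 0⟩ P).zCoord = (u : L) * P.zCoord := by
  rcases P with _ | ⟨x, y, h⟩
  · rw [← Affine.Point.zero_def, map_zero, Affine.Point.zCoord_zero, Affine.Point.zCoord_zero,
      mul_zero]
  · rw [VariableChange.pointEquiv_some, Affine.Point.zCoord_some, Affine.Point.zCoord_some,
      VariableChange.toX_def, VariableChange.toY_def]
    simp only [sub_zero, zero_mul, Units.val_inv_eq_inv_val]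
    by_cases hy : y = 0
    · rw [hy, mul_zero, div_zero, div_zero, mul_zero]
    · have hu : (u : L) ≠ 0 := u.ne_zero
      field_simp

/-! ### Congruences modulo the maximal ideal -/

/-- `x ≡ y` modulo the maximal ideal implies `xᵏ ≡ yᵏ` (for integral `x`, `y`). [folklore] -/
theorem val_pow_sub_pow_lt_one {L : Type*} [Field L] (w : Valuation L ℝ≥0) {x y : L}
    (hx : w x ≤ 1) (hy : w y ≤ 1) (h : w (x - y) < 1) (k : ℕ) : w (x ^ k - y ^ k) < 1 := by
  induction k with
  | zero => rw [pow_zero, pow_zero, sub_self, map_zero]; exact zero_lt_one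
  | succ k ih =>
    have e : x ^ (k + 1) - y ^ (k + 1) = x * (x ^ k - y ^ k) + (x - y) * y ^ k := by ring
    rw [e]
    refine Valuation.map_add_lt w ?_ ?_
    · rw [map_mul]
      calc w x * w (x ^ k - y ^ k) ≤ 1 * w (x ^ k - y ^ k) := by gcongr
        _ < 1 := by rw [one_mul]; exact ih
    · rw [map_mul, map_pow]
      calc w (x - y) * w y ^ k ≤ w (x - y) * 1 := by gcongr; exact pow_le_one₀ zero_le hy
        _ < 1 := by rw [mul_one]; exact h

/-- **Roots of unity of order prime to the residue characteristic are distinct modulo the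
maximal ideal**: if `η^M = 1`, `|M| = 1` and `η ≡ 1`, then `η = 1`
(`η^M - 1 = (η - 1)(1 + η + ⋯ + η^{M-1})` and the second factor is `≡ M`, a unit).
[cite: Serre1972, §1.3] -/
theorem eq_one_of_pow_eq_one_of_val_sub_one_lt {L : Type*} [Field L] (w : Valuation L ℝ≥0)
    {M : ℕ} (hM : w (M : L) = 1) {η : L} (hη : η ^ M = 1) (hlt : w (η - 1) < 1) : η = 1 := by
  by_contra hne
  have hη1 : w η ≤ 1 := by
    have : w (η - 1 + 1) ≤ max (w (η - 1)) (w 1) := w.map_add _ _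
    rw [sub_add_cancel, map_one] at this
    exact this.trans (max_le hlt.le le_rfl)
  set S : L := ∑ i ∈ Finset.range M, η ^ i with hS
  have hS0 : S = 0 := by
    have h := mul_geom_sum η M
    rw [hη, sub_self] at h
    rcases mul_eq_zero.mp h with h1 | h1
    · exact absurd (sub_eq_zero.mp h1) hne
    · exact h1
  have hSM : w (S - M) < 1 := by
    have e : S - M = ∑ i ∈ Finset.range M, (η ^ i - 1 ^ i) := by
      rw [hS, Finset.sum_sub_distrib]
      simp
    rw [e]
    refine Valuation.map_sum_lt w one_ne_zero fun i _ ↦ ?_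
    exact val_pow_sub_pow_lt_one w hη1 (le_of_eq (map_one w)) hlt i
  rw [hS0, zero_sub, Valuation.map_neg, hM] at hSM
  exact lt_irrefl _ hSM

/-- Natural numbers have value `≤ 1` under any valuation. [folklore] -/
theorem val_natCast_le_one {L : Type*} [Field L] (w : Valuation L ℝ≥0) (n : ℕ) :
    w (n : L) ≤ 1 := by
  induction n with
  | zero => rw [Nat.cast_zero, map_zero]; exact zero_le_one
  | succ n ih =>
    rw [Nat.cast_succ]
    exact (w.map_add _ _).trans (max_le ih (le_of_eq (map_one w)))

/-- **`a ≡ cᵏ⁰ (mod N)` read in `ℚ̄`**: if `(a : ℤ/N) = (c : ℤ/N)ᵏ⁰` then `|a - cᵏ⁰| < 1` for a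
valuation with `|N| < 1` and `|x| ≤ 1` on algebraic integers. [folklore] -/
theorem val_natCast_sub_pow_lt_one (w : Valuation (AlgebraicClosure ℚ) ℝ≥0) {N : ℕ}
    (hNlt : w (N : AlgebraicClosure ℚ) < 1)
    (hintg : ∀ x : AlgebraicClosure ℚ, IsIntegral ℤ x → w x ≤ 1) {a c k₀ : ℕ}
    (h : ((a : ℕ) : ZMod N) = ((c : ℕ) : ZMod N) ^ k₀) :
    w ((a : AlgebraicClosure ℚ) - (c : AlgebraicClosure ℚ) ^ k₀) < 1 := by
  let L := AlgebraicClosure ℚ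
  have h1 : (((a : ℤ) - (c : ℤ) ^ k₀ : ℤ) : ZMod N) = 0 := by
    push_cast
    rw [h, sub_self]
  obtain ⟨m, hm⟩ := (ZMod.intCast_zmod_eq_zero_iff_dvd _ N).mp h1
  have h2 := congrArg (algebraMap ℤ L) hm
  rw [map_sub, map_pow, map_mul, map_natCast, map_natCast, map_natCast] at h2
  rw [h2, map_mul]
  calc w (N : L) * w (algebraMap ℤ L m) ≤ w (N : L) * 1 := by
        gcongr; exact hintg _ isIntegral_algebraMap
    _ < 1 := by rw [mul_one]; exact hNlt

/-- **The cyclotomic comparison `ξ ≡ χ̄_N(τ)`.** Let `π₀ = ζ_N - 1` (`π₀^{N-1} = N ε`, `ε` a unit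
of `\bar ℤ`) and `ρ₁` (`ρ₁^{N-1} = N`) be two `(N-1)`-th roots of `N` up to units, `τ` an inertial
isometry with `τρ₁ = ξρ₁` (`|ξ| = 1`) and `τπ₀ = π₀ (c + π₀ m)` (`m ∈ \bar ℤ`; `c = χ̄_N(τ)`).
Then `|ξ - c| < 1`: `π₀ = ρ₁ y` with `|y| = 1`, `τ y ≡ y`, so `ξ π₀ ≡ τ π₀ ≡ c π₀ (mod π₀⁺)`
(Serre 1972, §1 Prop. 8: `χ = θᵉ` on inertia). [cite: Serre1972, §1 Prop. 8] -/
theorem val_sub_natCast_lt_one_of_uniformisers (w : Valuation (AlgebraicClosure ℚ) ℝ≥0) {N : ℕ}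
    (hN : N.Prime) (hN1 : 0 < N - 1) (hNlt : w (N : AlgebraicClosure ℚ) < 1)
    (hintg : ∀ x : AlgebraicClosure ℚ, IsIntegral ℤ x → w x ≤ 1) {τ : absoluteGaloisGroup ℚ}
    (hinert : ∀ z : AlgebraicClosure ℚ, w z ≤ 1 → w (τ • z - z) < 1)
    {ζN : AlgebraicClosure ℚ} (hζN : IsPrimitiveRoot ζN N) {ε : AlgebraicClosure ℚ}
    (hεi : IsIntegral ℤ ε) (hεi' : IsIntegral ℤ ε⁻¹)
    (hε : (ζN - 1) ^ (N - 1) = (N : AlgebraicClosure ℚ) * ε) {ρ₁ ξ : AlgebraicClosure ℚ}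
    (hρ₁N : ρ₁ ^ (N - 1) = N) (hwξ : w ξ = 1) (hτρ₁ : τ • ρ₁ = ξ * ρ₁) {c : ℕ}
    {m₁ : AlgebraicClosure ℚ} (hm₁i : IsIntegral ℤ m₁)
    (hm₁ : τ • (ζN - 1) = (ζN - 1) * ((c : AlgebraicClosure ℚ) + (ζN - 1) * m₁)) :
    w (ξ - (c : AlgebraicClosure ℚ)) < 1 := by
  let L := AlgebraicClosure ℚ
  set t : ℝ≥0 := w (N : L) with htdef
  set π₀ : L := ζN - 1 with hπ₀
  have hwε : w ε = 1 := by
    have h1 : w ε ≤ 1 := hintg ε hεi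
    have h2 : w ε⁻¹ ≤ 1 := hintg _ hεi'
    have hε0 : ε ≠ 0 := by
      intro h0
      rw [h0, mul_zero, pow_eq_zero_iff hN1.ne', sub_eq_zero] at hε
      exact hζN.ne_one hN.one_lt hε
    rw [map_inv₀] at h2
    exact le_antisymm h1 ((inv_le_one₀ (zero_lt_iff.mpr ((Valuation.ne_zero_iff w).mpr hε0))).mp h2)
  have hπ₀0 : π₀ ≠ 0 := fun h0 ↦ hζN.ne_one hN.one_lt (sub_eq_zero.mp h0)
  have hρ₁0 : ρ₁ ≠ 0 := by
    intro h0
    rw [h0, zero_pow hN1.ne'] at hρ₁N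
    exact (Nat.cast_ne_zero.mpr hN.ne_zero) hρ₁N.symm
  have hwπ₀ : w π₀ ^ (N - 1) = t := by rw [← map_pow, hε, map_mul, hwε, mul_one]
  have hwρ₁ : w ρ₁ ^ (N - 1) = t := by rw [← map_pow, hρ₁N]
  have hπρ : w π₀ = w ρ₁ := (pow_left_inj₀ zero_le zero_le hN1.ne').mp (hwπ₀.trans hwρ₁.symm)
  have hwπ₀pos : 0 < w π₀ := zero_lt_iff.mpr ((Valuation.ne_zero_iff w).mpr hπ₀0)
  -- (i) `τ π₀ ≡ c π₀ (mod π₀²)`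
  have h1 : w (τ • π₀ - (c : L) * π₀) < w π₀ := by
    have e1 : τ • π₀ - (c : L) * π₀ = π₀ * π₀ * m₁ := by rw [hm₁]; ring
    have hwπ₀lt : w π₀ < 1 := by
      by_contra hge
      rw [not_lt] at hge
      have : 1 ≤ w π₀ ^ (N - 1) := one_le_pow₀ hge
      rw [hwπ₀] at this
      exact absurd hNlt (not_lt.mpr this)
    rw [e1, map_mul, map_mul]
    calc w π₀ * w π₀ * w m₁ ≤ w π₀ * w π₀ * 1 := by gcongr; exact hintg m₁ hm₁i
      _ < w π₀ * 1 * 1 := by gcongr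
      _ = w π₀ := by rw [mul_one, mul_one]
  -- (ii) `τ π₀ ≡ ξ π₀` through `π₀ = ρ₁ y₁`, `τ ρ₁ = ξ ρ₁`, `τ y₁ ≡ y₁`
  set y₁ : L := π₀ / ρ₁ with hy₁
  have hπy : π₀ = ρ₁ * y₁ := by rw [hy₁, mul_div_cancel₀ _ hρ₁0]
  have hwy₁ : w y₁ = 1 := by
    rw [hy₁, map_div₀, hπρ, div_self ((Valuation.ne_zero_iff w).mpr hρ₁0)]
  have h2 : w (τ • π₀ - ξ * π₀) < w π₀ := by
    have e2 : τ • π₀ - ξ * π₀ = ξ * ρ₁ * (τ • y₁ - y₁) := by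
      rw [hπy, smul_mul', hτρ₁]; ring
    rw [e2, map_mul, map_mul, hwξ, one_mul, ← hπρ]
    calc w π₀ * w (τ • y₁ - y₁) < w π₀ * 1 := by gcongr; exact hinert y₁ hwy₁.le
      _ = w π₀ := mul_one _
  -- (iii) so `(ξ - c) π₀ ≡ 0 (mod π₀⁺)`
  have h3 : w ((ξ - (c : L)) * π₀) < w π₀ := by
    have e3 : (ξ - (c : L)) * π₀ = (τ • π₀ - (c : L) * π₀) - (τ • π₀ - ξ * π₀) := by ring
    rw [e3]
    exact Valuation.map_sub_lt w h1 h2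
  rw [map_mul] at h3
  calc w (ξ - (c : L)) = w (ξ - (c : L)) * w π₀ / w π₀ := by
        rw [mul_div_assoc, div_self hwπ₀pos.ne', mul_one]
    _ < w π₀ / w π₀ := by gcongr
    _ = 1 := div_self hwπ₀pos.ne'

/-! ### Inertia elements fixing the twist act trivially on the reduction -/

/-- **An inertia element fixing the change of variables acts trivially on the reduction of the
good model** (Serre–Tate mechanism with trivial reduced automorphism, the tree's
`exists_integralLift_reducedAut_red_map_eq`): for `σ ∈ Γ_ℚ` an isometry of `(ℚ̄, w)` acting
trivially on the residue field and fixing `C`, and a point `P` with `σP = aP`, the reductions of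
`Φ(aP)` and `Φ(P)` on the good model `W₀` (`C • X_{ℚ̄} = W₀ ⊗ ℚ̄`) coincide.
[cite: SilvermanAEC2009, VII.2 Prop. 2.1] -/
theorem goodReductionHom_nsmul_eq (w : Valuation (AlgebraicClosure ℚ) ℝ≥0) (X : WeierstrassCurve ℚ)
    (C : VariableChange (AlgebraicClosure ℚ)) {W₀ : WeierstrassCurve w.integer}
    (hW₀ : C • X.baseChange (AlgebraicClosure ℚ) = W₀.baseChange (AlgebraicClosure ℚ))
    (hΔ : IsUnit W₀.Δ) (σ : AlgebraicClosure ℚ ≃ₐ[ℚ] AlgebraicClosure ℚ)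
    (hσ : ∀ z, w (σ z) = w z) (hσI : ∀ z, w z ≤ 1 → w (σ z - z) < 1)
    (hC : C.map (σ : AlgebraicClosure ℚ →+* AlgebraicClosure ℚ) = C)
    {P : (X.baseChange (AlgebraicClosure ℚ)).toAffine.Point} {a : ℕ}
    (hP : Affine.Point.map (σ : AlgebraicClosure ℚ →ₐ[ℚ] AlgebraicClosure ℚ) P = a • P) :
    goodReductionHom W₀ (Valuation.integer.integers w) hΔ
        (Affine.Point.congrEquiv hW₀ (VariableChange.pointEquiv _ C (a • P))) =
      goodReductionHom W₀ (Valuation.integer.integers w) hΔ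
        (Affine.Point.congrEquiv hW₀ (VariableChange.pointEquiv _ C P)) := by
  set L := AlgebraicClosure ℚ
  have hv0 : w.Integers w.integer := Valuation.integer.integers w
  obtain ⟨A₀, hÃ, hA₀, hred⟩ := exists_integralLift_reducedAut_red_map_eq X C hW₀ hΔ σ hσ hσI
  rw [hC, mul_inv_cancel] at hA₀
  -- `A₀ = 1`
  have hinj : Function.Injective (algebraMap w.integer L) := hv0.hom_inj
  have hA1 : A₀ = 1 := VariableChange.map_injective hinj
    (hA₀.trans ((VariableChange.mapHom (algebraMap w.integer L)).map_one).symm)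
  have hA1' : A₀.map (IsLocalRing.residue w.integer) = 1 := by
    rw [hA1]; exact (VariableChange.mapHom _).map_one
  have h := hred P
  rw [hP, VariableChange.congrEquiv_pointEquiv_eq_self_of_eq_one hÃ hA1'] at h
  exact h

end Summit.ABC.ABC.Theorems

end
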